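import Summits.QuantumFields.YangMills.Theorems.FemtoCutoffLadderFixedLatticeLawValleyOfFloor
import Summits.QuantumFields.YangMills.Theorems.FemtoCutoffLadderFixedLatticeLawInnerRateBO
import Summits.QuantumFields.YangMills.Theorems.FemtoCutoffLadderFixedLatticeLawRateGlue
import Summits.QuantumFields.YangMills.Theorems.LuscherReductionTwistedTraceScalingFloorNormalisation
import Summits.QuantumFields.YangMills.Theorems.LuscherReductionOneSiteLevelsClosed
import HarnessLib

/-!
# `stub_valleyGain` of crux `FixedLatticeLaw` (stmt-QuantumFields-23943 ≡ leaf `FemtoGapFixedLattice`, route `FemtoCutoffLadder`, line «rate») is PROVED for every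
# lattice size `L ≥ 2`; the crux ⟸ the Born–Oppenheimer data with rate on `L ≥ 2` ALONE

Lead seat `ym-line-fcl-p1` g4 (2026-08-28).  Route RED's lane A (ym-luscher-20007-p1 g10) has landed the whole k = 0 FLOOR of its VALLEY programme for `L ≥ 2`:
`vacuumFloorAt_ideal`, `valleyFloorAt_of_idealCmp_pow` (`…TwistedTraceScalingFloorAssembly`, p597156) and the normalisation comparison `riccatiN_idealCmp_pow`
(`…FloorNormalisation`, p597574).  With this seat's glue `valleyGainAt_of_floor_pow` (`…FixedLatticeLawValleyOfFloor`, p597717):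
* ★★★ `valleyGainAt_pow_of_two_le` — for `L ≥ 2` and RED's exponent window (`0 < p < 1/10`, `4p < q < 8/9`-free, `0 < r`, `2r < 1`, `0 < m`, `2r < q − m/2`, `p < m/2`,
  `1 + 3m − 3r < −p`): `ValleyGainAt L (powScale p) (powScale q)` — UNCONDITIONALLY; ★★★ `valleyGainAt_ledger` — at the ledger `(1/40, 17/20, 41/100, 11/200)`:
  `2 ≤ L → ValleyGainAt L (powScale (1/40)) (powScale (17/20))`, i.e. the registered stub `stub_valleyGain` for every `L ≥ 2` (at `L = 1` the leaf is crux ONE itself,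
  `femtoGapOneSite_proof`, so the valley text is never needed there);
* ★★★ `femtoGapFixedLatticeAt_of_bo` — for `L ≥ 2`, the LEAF'S BODY at `L` from the Born–Oppenheimer data with rate ALONE (door `innerRateAt_of_bo_pow` p599058 at `k = 1`,
  `p = 1/40` + the valley above + the landed `O(λ_b²)` endgame `femtoGapFixedLatticeAt_of_valley_innerRate` p594457);
* ★★★★ `femtoGapFixedLattice_of_bo` — `FemtoGapFixedLattice` (≡ crux 23943 `FixedLatticeLaw` by `Iff.rfl`) from the Born–Oppenheimer data with rate on every `L ≥ 2`;
  the `L = 1` clause is crux ONE (`femtoGapOneSite_proof`).  So crux 23943 = EXACTLY ONE open text: the adiabatic split (P1)(P3)(P4)(P5)(P6) + floor with rate at level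
  one, inner scale `β^{−1/40}`, for every `L ≥ 2` (C4 of RED's COARSE(L) with a rate, in Born–Oppenheimer form).
HONEST FRAMING: the valley half is RED's theorem (cited by name, not restated); the BO data is OPEN (XL fixed-lattice semiclassics) and NOT proved here; femto rung R2b1
(RECORD label) — not infinite volume, not a mass gap, not Clay.  No definitions, no named facts, no `sorry`.
-/

set_option autoImplicit false

noncomputable section

open MeasureTheory Filter Topology Real
open scoped BigOperators
open Literature.MathematicalPhysics.QuantumFieldTheory hiding SU2
open Literature.MathematicalPhysics.QuantumLattice
open Literature.Analysis.OperatorTheory.YMMatrixModel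

namespace Summit.QuantumFields.YangMills.Theorems.FemtoCutoffLadder

open Summit.QuantumFields.YangMills.Theorems.FemtoTransferGap

variable {L : ℕ} [NeZero L]

/-! ## §1 VALLEY GAIN for `L ≥ 2`, unconditionally -/

/-- ★★★ **VALLEY GAIN for `L ≥ 2` at polynomial scales, UNCONDITIONALLY**: for `0 < p < 1/10`, `4p < q`, `0 < r`, `2r < 1`, `0 < m`, `2r < q − m/2`, `p < m/2`,
`1 + 3m − 3r < −p`: `ValleyGainAt L (powScale p) (powScale q)` — RED's k = 0 floor (`valleyFloorAt_of_idealCmp_pow` + `riccatiN_idealCmp_pow`) fed into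
`valleyGainAt_of_floor_pow`. [cite: Luscher1983, §3] [cite: LuscherMunster1984, §2] -/
theorem valleyGainAt_pow_of_two_le (hL : 2 ≤ L) {p q r m : ℝ} (hp0 : 0 < p) (hp : p < 1 / 10) (hpq : 4 * p < q) (hr : 0 < r) (hr1 : 2 * r < 1)
    (hm : 0 < m) (hrq : 2 * r < q - m / 2) (hpm : p < m / 2) (hC : 1 + 3 * m - 3 * r < -p) :
    ValleyGainAt L (powScale p) (powScale q) :=
  valleyGainAt_of_floor_pow hp0 (by linarith) hpq hr hr1 hm hrq
    (valleyFloorAt_of_idealCmp_pow hL hp (riccatiN_idealCmp_pow (L := L) hp0 hpm (by linarith) hC hm.le))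

/-- ★★★ **`stub_valleyGain` for every `L ≥ 2`**: `ValleyGainAt L (powScale (1/40)) (powScale (17/20))` at RED's ledger `(r, m) = (41/100, 11/200)`
(`innerPow_window_nonempty`). [cite: Luscher1983, §3] [cite: LuscherMunster1984, §2] -/
theorem valleyGainAt_ledger (hL : 2 ≤ L) : ValleyGainAt L (powScale (1 / 40)) (powScale (17 / 20)) :=
  valleyGainAt_pow_of_two_le hL (r := 41 / 100) (m := 11 / 200) (by norm_num) (by norm_num) (by norm_num) (by norm_num) (by norm_num) (by norm_num)
    (by norm_num) (by norm_num) (by norm_num)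

/-! ## §2 The crux from the Born–Oppenheimer data with rate alone -/

/-- ★★★ **The LEAF'S BODY at `L ≥ 2` from the Born–Oppenheimer data with rate ALONE** (the hypothesis `hBO` of `oneOrbitRate_of_bo` at `k = 1`, `δ = β^{−1/40}`):
valley (`valleyGainAt_ledger`) + door (`innerRateAt_of_bo_pow`) + `O(λ_b²)` endgame (`femtoGapFixedLatticeAt_of_valley_innerRate`).
[cite: Luscher1983, §3] [cite: LuscherMunster1984, §2] [cite: GustafsonSigal2003, §11–§12] -/
theorem femtoGapFixedLatticeAt_of_bo (hL : 2 ≤ L)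
    (hBO : ∃ C gap βB : ℝ, 0 < gap ∧ ∀ β : ℝ, βB ≤ β →
      ∃ N : ℝ, 0 < N ∧
        N * levelValue su2Rep 1 ((L : ℝ) ^ 3 * β) 0 * Real.exp (-(C * bareLambda ((L : ℝ) ^ 3 * β) ^ 2)) ≤ levelValue su2Rep L β 0 ∧
        ∀ G : Fin 2 → (GaugeConfig 3 L SU2 → ℝ),
          (∀ i, Measurable (G i)) → (∀ i, ∃ C' : ℝ, ∀ U, |G i U| ≤ C') →
          (∀ i (g : Site 3 L → SU2) (U : GaugeConfig 3 L SU2), G i (gaugeTransform g U) = G i U) →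
          (∀ i U, G i U ≠ 0 → orbitDist U < powScale (1 / 40) β) →
          ∃ (φ : Fin 2 → (GaugeConfig 3 L SU2 → ℝ)) (g : Fin 2 → (GaugeConfig 3 1 SU2 → ℝ)),
            (∀ i, Measurable (φ i)) ∧ (∀ i, ∃ C' : ℝ, ∀ U, |φ i U| ≤ C') ∧ (∀ i, IsPhys (g i)) ∧
            ∀ a : Fin 2 → ℝ,
              2 * |l2 (fun U => ∑ i, a i * φ i U) (fun U => ∑ i, a i * G i U - ∑ i, a i * φ i U)| ≤
                  C * bareLambda ((L : ℝ) ^ 3 * β) ^ 2 *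
                    (l2 (fun U => ∑ i, a i * φ i U) (fun U => ∑ i, a i * φ i U) +
                      l2 (fun U => ∑ i, a i * G i U - ∑ i, a i * φ i U) (fun U => ∑ i, a i * G i U - ∑ i, a i * φ i U)) ∧
              qform su2Rep β (fun U => ∑ i, a i * G i U - ∑ i, a i * φ i U) (fun U => ∑ i, a i * G i U - ∑ i, a i * φ i U) ≤
                  (1 - gap) * (N * levelValue su2Rep 1 ((L : ℝ) ^ 3 * β) 1) *
                    l2 (fun U => ∑ i, a i * G i U - ∑ i, a i * φ i U) (fun U => ∑ i, a i * G i U - ∑ i, a i * φ i U) ∧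
              qform su2Rep β (fun U => ∑ i, a i * φ i U) (fun U => ∑ i, a i * G i U - ∑ i, a i * φ i U) ^ 2 ≤
                  C * bareLambda ((L : ℝ) ^ 3 * β) ^ 2 * (N * levelValue su2Rep 1 ((L : ℝ) ^ 3 * β) 1) ^ 2 *
                    (l2 (fun U => ∑ i, a i * φ i U) (fun U => ∑ i, a i * φ i U) *
                      l2 (fun U => ∑ i, a i * G i U - ∑ i, a i * φ i U) (fun U => ∑ i, a i * G i U - ∑ i, a i * φ i U)) ∧
              qform su2Rep β (fun U => ∑ i, a i * φ i U) (fun U => ∑ i, a i * φ i U) ≤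
                  Real.exp (C * bareLambda ((L : ℝ) ^ 3 * β) ^ 2) * N *
                      qform su2Rep ((L : ℝ) ^ 3 * β) (fun U => ∑ i, a i * g i U) (fun U => ∑ i, a i * g i U) +
                    C * bareLambda ((L : ℝ) ^ 3 * β) ^ 2 * (N * levelValue su2Rep 1 ((L : ℝ) ^ 3 * β) 1) *
                      l2 (fun U => ∑ i, a i * φ i U) (fun U => ∑ i, a i * φ i U) ∧
              l2 (fun U => ∑ i, a i * g i U) (fun U => ∑ i, a i * g i U) ≤
                  Real.exp (C * bareLambda ((L : ℝ) ^ 3 * β) ^ 2) * l2 (fun U => ∑ i, a i * φ i U) (fun U => ∑ i, a i * φ i U)) :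
    ∃ C β0 : ℝ, ∀ β : ℝ, β0 ≤ β →
      secondValue su2Rep L β ≤
        Real.exp (-(luscherEps1 * bareLambda β - C * bareLambda β ^ 2) / L) * topValue su2Rep L β :=
  femtoGapFixedLatticeAt_of_valley_innerRate (L := L) (p := 1 / 40) (q := 17 / 20) (by norm_num) (by norm_num) (by norm_num)
    (valleyGainAt_ledger hL) (innerRateAt_of_bo_pow (L := L) 1 (p := 1 / 40) (by norm_num) hBO)

/-- ★★★★ **THE CRUX FROM THE BORN–OPPENHEIMER DATA WITH RATE ON `L ≥ 2`**: `FemtoGapFixedLattice` (≡ crux 23943 `FixedLatticeLaw`, `Iff.rfl`) follows from the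
adiabatic split (P1)(P3)(P4)(P5)(P6) + floor with rate at level one, inner scale `β^{−1/40}`, on every lattice of size `L ≥ 2`; at `L = 1` the leaf is crux ONE
(`femtoGapOneSite_proof`). [cite: Luscher1983, §3] [cite: LuscherMunster1984, §2] [cite: GustafsonSigal2003, §11–§12] -/
theorem femtoGapFixedLattice_of_bo
    (hBO : ∀ (L : ℕ) [NeZero L], 2 ≤ L →
      ∃ C gap βB : ℝ, 0 < gap ∧ ∀ β : ℝ, βB ≤ β →
        ∃ N : ℝ, 0 < N ∧
          N * levelValue su2Rep 1 ((L : ℝ) ^ 3 * β) 0 * Real.exp (-(C * bareLambda ((L : ℝ) ^ 3 * β) ^ 2)) ≤ levelValue su2Rep L β 0 ∧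
          ∀ G : Fin 2 → (GaugeConfig 3 L SU2 → ℝ),
            (∀ i, Measurable (G i)) → (∀ i, ∃ C' : ℝ, ∀ U, |G i U| ≤ C') →
            (∀ i (g : Site 3 L → SU2) (U : GaugeConfig 3 L SU2), G i (gaugeTransform g U) = G i U) →
            (∀ i U, G i U ≠ 0 → orbitDist U < powScale (1 / 40) β) →
            ∃ (φ : Fin 2 → (GaugeConfig 3 L SU2 → ℝ)) (g : Fin 2 → (GaugeConfig 3 1 SU2 → ℝ)),
              (∀ i, Measurable (φ i)) ∧ (∀ i, ∃ C' : ℝ, ∀ U, |φ i U| ≤ C') ∧ (∀ i, IsPhys (g i)) ∧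
              ∀ a : Fin 2 → ℝ,
                2 * |l2 (fun U => ∑ i, a i * φ i U) (fun U => ∑ i, a i * G i U - ∑ i, a i * φ i U)| ≤
                    C * bareLambda ((L : ℝ) ^ 3 * β) ^ 2 *
                      (l2 (fun U => ∑ i, a i * φ i U) (fun U => ∑ i, a i * φ i U) +
                        l2 (fun U => ∑ i, a i * G i U - ∑ i, a i * φ i U) (fun U => ∑ i, a i * G i U - ∑ i, a i * φ i U)) ∧
                qform su2Rep β (fun U => ∑ i, a i * G i U - ∑ i, a i * φ i U) (fun U => ∑ i, a i * G i U - ∑ i, a i * φ i U) ≤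
                    (1 - gap) * (N * levelValue su2Rep 1 ((L : ℝ) ^ 3 * β) 1) *
                      l2 (fun U => ∑ i, a i * G i U - ∑ i, a i * φ i U) (fun U => ∑ i, a i * G i U - ∑ i, a i * φ i U) ∧
                qform su2Rep β (fun U => ∑ i, a i * φ i U) (fun U => ∑ i, a i * G i U - ∑ i, a i * φ i U) ^ 2 ≤
                    C * bareLambda ((L : ℝ) ^ 3 * β) ^ 2 * (N * levelValue su2Rep 1 ((L : ℝ) ^ 3 * β) 1) ^ 2 *
                      (l2 (fun U => ∑ i, a i * φ i U) (fun U => ∑ i, a i * φ i U) *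
                        l2 (fun U => ∑ i, a i * G i U - ∑ i, a i * φ i U) (fun U => ∑ i, a i * G i U - ∑ i, a i * φ i U)) ∧
                qform su2Rep β (fun U => ∑ i, a i * φ i U) (fun U => ∑ i, a i * φ i U) ≤
                    Real.exp (C * bareLambda ((L : ℝ) ^ 3 * β) ^ 2) * N *
                        qform su2Rep ((L : ℝ) ^ 3 * β) (fun U => ∑ i, a i * g i U) (fun U => ∑ i, a i * g i U) +
                      C * bareLambda ((L : ℝ) ^ 3 * β) ^ 2 * (N * levelValue su2Rep 1 ((L : ℝ) ^ 3 * β) 1) *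
                        l2 (fun U => ∑ i, a i * φ i U) (fun U => ∑ i, a i * φ i U) ∧
                l2 (fun U => ∑ i, a i * g i U) (fun U => ∑ i, a i * g i U) ≤
                    Real.exp (C * bareLambda ((L : ℝ) ^ 3 * β) ^ 2) * l2 (fun U => ∑ i, a i * φ i U) (fun U => ∑ i, a i * φ i U)) :
    FemtoGapFixedLattice := by
  intro L _
  by_cases hL : 2 ≤ L
  · exact femtoGapFixedLatticeAt_of_bo hL (hBO L hL)
  · have hL1 : L = 1 := by
      have h0 : L ≠ 0 := NeZero.ne L
      omega
    subst hL1
    exact femtoGapOneSite_proof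

end Summit.QuantumFields.YangMills.Theorems.FemtoCutoffLadder

end
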